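import Literature.Computability.AlgebraicComplexity.BorderRankMatMulTwoApolarity
import Literature.Computability.AlgebraicComplexity.BorderRankMatMulTwoSeven
import HarnessLib

/-!
# `R̲(⟨2,2,2⟩) = 7` (Landsberg 2006): the discharge of `Landsberg2005_borderRank_matMulTensor_two`

Topic `Literature/Computability/AlgebraicComplexity`. Theorems only: the named fact
`Landsberg2005_borderRank_matMulTensor_two : algBorderRank (matMulTensor ℂ 2 2 2) = 7`
(`BorderRankMatMulSmall.lean`) follows from its lower half
(`Landsberg2005_borderRank_matMulTensor_two_iff_seven_le`, `BorderRankMatMulTwoSeven.lean`), which is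
`MatMulTwo.seven_le_algBorderRank_matMulTensor_two` (`BorderRankMatMulTwoApolarity.lean`, torus-fixed
border apolarity after Conner–Harper–Landsberg 2023, §5).

## References

* J. M. Landsberg, *The border rank of the multiplication of `2 × 2` matrices is seven*, J. Amer.
  Math. Soc. 19 (2006) 447–459. [Landsberg2005]
-/

noncomputable section

namespace Literature.Computability.AlgebraicComplexity

/-- **Landsberg 2006: `R̲(⟨2,2,2⟩) = 7`** — the named fact `Landsberg2005_borderRank_matMulTensor_two`,
DISCHARGED for the tree's algebraic border rank over `ℂ[ε]`. [cite: Landsberg2005, main theorem (p. 447)] -/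
theorem Landsberg2005_borderRank_matMulTensor_two_holds : Landsberg2005_borderRank_matMulTensor_two :=
  Landsberg2005_borderRank_matMulTensor_two_iff_seven_le.2
    (MatMulTwo.seven_le_algBorderRank_matMulTensor_two ℂ)


/-- **`R̲(⟨2,2,2⟩) = 7` over EVERY field of characteristic `0`** (Landsberg 2006, stated there over
`ℂ`; the lower bound `MatMulTwo.seven_le_algBorderRank_matMulTensor_two` — torus-fixed border
apolarity after Conner–Harper–Landsberg 2023, §5 — is proved for any such field, and Strassen's
upper bound `algBorderRank_matMulTensor_two_le_seven` over any commutative ring), for the algebraic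
border rank over `K[ε]`. [cite: Landsberg2005, main theorem (p. 447)]
[cite: ConnerHarperLandsberg2023, §5] -/
theorem algBorderRank_matMulTensor_two (K : Type*) [Field K] [CharZero K] :
    algBorderRank (matMulTensor K 2 2 2) = 7 :=
  le_antisymm (algBorderRank_matMulTensor_two_le_seven K)
    (MatMulTwo.seven_le_algBorderRank_matMulTensor_two K)

end Literature.Computability.AlgebraicComplexity

end
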